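import Summits.BirchSwinnertonDyer.BirchSwinnertonDyer.Theorems.SignedLowerHalvesSmallImageLowerHalfBothSignsRttD2SeqSemilocLayerPairing
import Summits.BirchSwinnertonDyer.BirchSwinnertonDyer.Theorems.SignedLowerHalvesSmallImageLowerHalfBothSignsRttD2SeqGlobalLayerColimit
import HarnessLib

/-!
# Route `SignedLowerHalves`, crux L `SmallImageLowerHalfBothSigns` (stmt-BirchSwinnertonDyer-23599), line `rtt_w3` v30 — stub S3β″ (`stub_junctionPT_ns`, row J4′,
# Poitou–Tate half), brick N2c: THE SEMILOCAL TOWER PAIRING `𝐇¹_{Iw,w} × H¹(Gal(K̄/K_∞), M) → ℚ/ℤ` —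
# `⟨h, res_n c⟩_{w,∞} := ⟨h, c⟩_{w,n}` on the colimit `H¹(Gal(K̄/K_∞), M) = lim→_n H¹(Gal(K̄/K_n), M)`, and its laws

WIDTH seat `bsd-line-slh-p3-w3` g26 under LEAD `cruxlead-stmt-BirchSwinnertonDyer-23599` g14 (cell `bsd-ssimc`); helper `--supports stmt-BirchSwinnertonDyer-23599`
(design memo `Lines/rtt_w3-DESIGN-S3beta-w3-g25.md`, rev 4 §6 RECIPE N2c). DEFINITIONS WITH BODIES (`SemilocIwasawaCohomologyDataO.repLayer/repClass/pairInfFun/pairInf`) +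
THEOREMS; no named fact, no instance, no `sorry`. The GLOBAL-LAYER twin of g22's `TowerPairing.pairInf` (p783849, local tower at `v`): exhaustion and kernel control for the global
layers `Gal(K̄/K_n) ↓ Gal(K̄/K_∞)` are g25's `…GlobalLayerColimit` (p813580); the layer pairings are N2b's `pairLayer` (`…SemilocLayerPairing`). HONEST FRAMING: bookkeeping for the map
`Φ : H′ → Y″` of brick N2 of S3β″ (its restriction to the saturated signed Selmer group and descent to `Sel_{str,v} ⧸ Sel_str` are brick N2d); nothing about S3β″, S3α′, crux L or BSD
is proved; all remain OPEN and are proved for NO curve.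

WHAT. For `L : SemilocIwasawaCohomologyDataO … w 1`, `h ∈ L.H = 𝐇¹_{Iw,w}`:
* `repLayer`/`repClass` (a layer representative of a class of `H¹(Gal(K̄/K_∞), M)`, exhaustion `exists_resOfLe_globalLayer_eq`), `pairInfFun`, ★ `pairInfFun_eq` (independence of the
  representative: kernel control `exists_resOfLe_globalLayer_eq_resOfLe_globalLayer` + N2b `pairLayer_resOfLe`);
* ★★ `L.pairInf … : L.H →+ (H¹(Gal(K̄/K_∞), M) →+ ℚ/ℤ)` with `pairInf_apply_resOfLe : ⟨h, res_n c⟩_{w,∞} = ⟨h, c⟩_{w,n}`;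
* LAWS: ★ `pairInf_X_smul` (`⟨T·h, x⟩ = ⟨h, conj_{γ⁻¹} x⟩ − ⟨h, x⟩`, from `pairLayer_X_smul` + `resOfLe ∘ conj = conj ∘ resOfLe`), ★ `pairInf_C_smul` (`⟨C a·h, x⟩ = ⟨h, a·x⟩`, from
  `pairLayer_C_smul` + `resOfLe ∘ scalarH1 = scalarH1 ∘ resOfLe`) — for honda's orientation `γ := γK⁻¹` exactly the action `T ↦ conj_{γK} − 1`, `C a ↦ a` forced on the Pontryagin duals
  `Y′ = Sel_str^∨`, `Y″ = (Sel_{str,v} ⧸ Sel_str)^∨` (`strictDualModule`, `locImageDualModule`), so that `Φ` will be `Λ`-linear.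
References: [PerrinRiou1994Invent] §3.6.1; [Kato2004Asterisque] §17.13; [Rubin2000] §4.2, App. B.2–B.3; [SerreGaloisCohomology1997] I §2.2 Prop. 8; [Kobayashi2003] Thm. 7.3 i).
-/

set_option autoImplicit false
set_option linter.dupNamespace false -- D-0017: single-problem summit, the namespace repeats the problem name by design
noncomputable section

open scoped Classical
open CategoryTheory Function NumberField IsDedekindDomain Field

namespace Summit.BirchSwinnertonDyer.BirchSwinnertonDyer.Theorems.SmallImageRttD2Seq

open Literature.NumberTheory.GaloisRepresentations Literature.NumberTheory.GaloisCohomology Literature.NumberTheory.EllipticCurves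
  Literature.NumberTheory.ComplexMultiplication.EllipticUnits Literature.NumberTheory.ComplexMultiplication.EllipticUnits.JohnsonLeungKings2011
  Literature.NumberTheory.GaloisRepresentations.DiscreteGaloisModule Literature.NumberTheory.GaloisCohomology.PoitouTateFinite
  Literature.AnabelianGeometry.AbsoluteAnabelian.Prop121vii
  Summit.BirchSwinnertonDyer.BirchSwinnertonDyer.Theorems.SmallImageRttD2J1

namespace SemilocIwasawaCohomologyDataO

section Tower

variable {K : Type} [Field K] [NumberField K] {p : ℕ} [Fact p.Prime] {S : Set (PadicAlgCl p)} [FiniteDimensional ℚ_[p] (padicCoeffField S)] {κ : ZpExtension K p}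
  {γ : absoluteGaloisGroup K} {θ' : absoluteGaloisGroup K →ₜ* (padicCoeffIntegers S)ˣ} {P : Set (HeightOneSpectrum (𝓞 K))} {w : HeightOneSpectrum (𝓞 K)}
  (L : SemilocIwasawaCohomologyDataO S κ γ θ' P w 1)
  (M : Type) [AddCommGroup M] [TopologicalSpace M] [DiscreteTopology M] [DistribMulAction (absoluteGaloisGroup K) M]
  (hstabK : ∀ m : M, IsOpen (MulAction.stabilizer (absoluteGaloisGroup K) m : Set (absoluteGaloisGroup K)))
  (PG : ∀ k : ℕ, ContPairing (coeffRepK S θ' P k).toTopRep (torsRep M hstabK p k).toTopRep (mu K (p ^ k)).toTopRep)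
  (hPred : ∀ (k : ℕ) (x : ↥(Representation.invariants ((muTwistO S θ' (k + 1)).toRepresentation.comp (ramificationSubgroup K P).subtype))) (m : ↥(torsionPow M p k)),
    (PG (k + 1)).toLin x (AddSubgroup.inclusion (torsionPow_mono (M := M) (p := p) (Nat.le_succ k)) m) =
      muInclusion K (pow_dvd_pow p (Nat.le_succ k)) ((PG k).toLin (coeffMapO S P θ' (oMuRed S k) (oMuRed_muTwistO S θ' k) x) m))
  (hM : ∀ m : M, ∃ k : ℕ, p ^ k • m = 0)

/-- A layer carrying a given class of `H¹(Gal(K̄/K_∞), M)` (a choice; exhaustion `exists_resOfLe_globalLayer_eq`, p813580). [cite: SerreGaloisCohomology1997, I §2.2 Prop. 8] -/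
def repLayer (x : subgroupH1 κ.kerSubgroup M) : ℕ :=
  (exists_resOfLe_globalLayer_eq (κ := κ) hstabK x).choose

/-- A layer class restricting to the given class of `H¹(Gal(K̄/K_∞), M)` (a choice). [cite: SerreGaloisCohomology1997, I §2.2 Prop. 8] -/
def repClass (x : subgroupH1 κ.kerSubgroup M) : subgroupH1 (κ.layerSubgroup (repLayer (κ := κ) M hstabK x)) M :=
  (exists_resOfLe_globalLayer_eq (κ := κ) hstabK x).choose_spec.choose

omit [NumberField K] in
/-- The chosen layer class restricts to `x`. [cite: SerreGaloisCohomology1997, I §2.2 Prop. 8] -/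
theorem resOfLe_repClass (x : subgroupH1 κ.kerSubgroup M) :
    resOfLe M (κ.kerSubgroup_le_layerSubgroup (repLayer (κ := κ) M hstabK x)) (repClass (κ := κ) M hstabK x) = x :=
  (exists_resOfLe_globalLayer_eq (κ := κ) hstabK x).choose_spec.choose_spec

/-- The tower pairing as a bare function: pair with the chosen layer representative. [cite: PerrinRiou1994Invent, §3.6.1] -/
def pairInfFun (h : L.H) (x : subgroupH1 κ.kerSubgroup M) : AddCircle (1 : ℚ) :=
  L.pairLayer M hstabK PG hPred hM (repLayer (κ := κ) M hstabK x) h (repClass (κ := κ) M hstabK x)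

/-- ★ **Independence of the representative**: `pairInfFun h x = ⟨h, c⟩_{w,n}` for EVERY layer class `c ∈ H¹(U_n, M)` restricting to `x` (kernel control for the global layers,
`exists_resOfLe_globalLayer_eq_resOfLe_globalLayer`, + compatibility of the layer pairings with restriction, `pairLayer_resOfLe`). [cite: SerreGaloisCohomology1997, I §2.2 Prop. 8]
[cite: NeukirchSchmidtWingberg2008, I §5 Prop. (1.5.3)(iv)] -/
theorem pairInfFun_eq (h : L.H) {n : ℕ} (c : subgroupH1 (κ.layerSubgroup n) M) (x : subgroupH1 κ.kerSubgroup M)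
    (hx : resOfLe M (κ.kerSubgroup_le_layerSubgroup n) c = x) :
    L.pairInfFun M hstabK PG hPred hM h x = L.pairLayer M hstabK PG hPred hM n h c := by
  obtain ⟨N, hN, hN', hres⟩ := exists_resOfLe_globalLayer_eq_resOfLe_globalLayer hstabK (repClass (κ := κ) M hstabK x) c
    ((resOfLe_repClass (κ := κ) M hstabK x).trans hx.symm)
  rw [pairInfFun, ← L.pairLayer_resOfLe M hstabK PG hPred hM hN h, hres, L.pairLayer_resOfLe M hstabK PG hPred hM hN' h]

/-- ★★ **THE SEMILOCAL TOWER PAIRING `⟨·, ·⟩_{w,∞} : 𝐇¹_{Iw,w} →+ Hom(H¹(Gal(K̄/K_∞), M), ℚ/ℤ)`** — the pairing of a semilocal Iwasawa class with the TOP global cohomology of the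
cyclotomic tower: on `res_n c` it is the layer pairing `⟨h, c⟩_{w,n}` (well defined by `pairInfFun_eq`; additive in both variables). Restricted to `Sel^{ε,S₀K}_{sat}(K_∞, M)` and summed over
`w ∈ S₀K` this is the semilocal side of the compact Poitou–Tate sequence behind S3β″. [cite: PerrinRiou1994Invent, §3.6.1] [cite: Kobayashi2003, Thm. 7.3 i)] [cite: Rubin2000, Thm. 1.7.3, App. B.3] -/
def pairInf : L.H →+ (subgroupH1 κ.kerSubgroup M →+ AddCircle (1 : ℚ)) where
  toFun h :=
    { toFun := L.pairInfFun M hstabK PG hPred hM h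
      map_zero' := by
        rw [L.pairInfFun_eq M hstabK PG hPred hM h (n := 0) 0 0 (map_zero _), map_zero]
      map_add' := fun x y ↦ by
        obtain ⟨n, c, hc⟩ := exists_resOfLe_globalLayer_eq (κ := κ) hstabK x
        obtain ⟨m, d, hd⟩ := exists_resOfLe_globalLayer_eq (κ := κ) hstabK y
        have hcL : resOfLe M (κ.kerSubgroup_le_layerSubgroup (max n m)) (resOfLe M (κ.layerSubgroup_antitone (le_max_left n m)) c) = x := by
          have h1 := DFunLike.congr_fun (resOfLe_comp_holds (M := M) (κ.kerSubgroup_le_layerSubgroup (max n m)) (κ.layerSubgroup_antitone (le_max_left n m))) c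
          rw [AddMonoidHom.comp_apply] at h1
          rw [h1]; exact hc
        have hdL : resOfLe M (κ.kerSubgroup_le_layerSubgroup (max n m)) (resOfLe M (κ.layerSubgroup_antitone (le_max_right n m)) d) = y := by
          have h1 := DFunLike.congr_fun (resOfLe_comp_holds (M := M) (κ.kerSubgroup_le_layerSubgroup (max n m)) (κ.layerSubgroup_antitone (le_max_right n m))) d
          rw [AddMonoidHom.comp_apply] at h1
          rw [h1]; exact hd
        rw [L.pairInfFun_eq M hstabK PG hPred hM h _ x hcL, L.pairInfFun_eq M hstabK PG hPred hM h _ y hdL,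
          L.pairInfFun_eq M hstabK PG hPred hM h (resOfLe M (κ.layerSubgroup_antitone (le_max_left n m)) c + resOfLe M (κ.layerSubgroup_antitone (le_max_right n m)) d)
            (x + y) (by rw [map_add, hcL, hdL]), map_add] }
  map_zero' := by
    ext x
    change L.pairInfFun M hstabK PG hPred hM 0 x = 0
    rw [pairInfFun, map_zero, AddMonoidHom.zero_apply]
  map_add' := fun h h' ↦ by
    ext x
    change L.pairInfFun M hstabK PG hPred hM (h + h') x = L.pairInfFun M hstabK PG hPred hM h x + L.pairInfFun M hstabK PG hPred hM h' x
    simp only [pairInfFun, map_add, AddMonoidHom.add_apply]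

/-- Unfolding `pairInf` (definitional). [cite: PerrinRiou1994Invent, §3.6.1] -/
theorem pairInf_apply (h : L.H) (x : subgroupH1 κ.kerSubgroup M) : L.pairInf M hstabK PG hPred hM h x = L.pairInfFun M hstabK PG hPred hM h x :=
  rfl

/-- ★ The defining identity: `⟨h, res_n c⟩_{w,∞} = ⟨h, c⟩_{w,n}`. [cite: PerrinRiou1994Invent, §3.6.1] [cite: Kato2004Asterisque, §17.13] -/
theorem pairInf_apply_resOfLe (h : L.H) (n : ℕ) (c : subgroupH1 (κ.layerSubgroup n) M) :
    L.pairInf M hstabK PG hPred hM h (resOfLe M (κ.kerSubgroup_le_layerSubgroup n) c) = L.pairLayer M hstabK PG hPred hM n h c := by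
  rw [pairInf_apply]
  exact L.pairInfFun_eq M hstabK PG hPred hM h c _ rfl

/-- ★★ `⟨h, res_n (torsToH1 ℓ)⟩_{w,∞} = ⟨proj_{n,k} h, semilocDual ℓ⟩_{w,n,k} / p^k` — the tower pairing EVALUATED on torsion-level data (the form in which T4's levelwise orthogonality hypothesis
reads it). [cite: Kobayashi2003, Thm. 7.3 i)] [cite: Rubin2000, Thm. 1.7.3] -/
theorem pairInf_apply_resOfLe_torsToH1 (h : L.H) (n k : ℕ) (ℓ : subgroupH1 (κ.layerSubgroup n) ↥(torsionPow M p k)) :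
    L.pairInf M hstabK PG hPred hM h (resOfLe M (κ.kerSubgroup_le_layerSubgroup n) (torsToH1 M p (κ.layerSubgroup n) k ℓ)) =
      semilocPairNKQ S κ θ' P M hstabK PG w n k (L.proj n k h) ℓ := by
  rw [pairInf_apply_resOfLe, pairLayer_apply_torsToH1, pairLevel_apply]

/-- ★ **The conjugation law on the top**: `⟨T·h, x⟩_{w,∞} = ⟨h, conj_{γ⁻¹} x⟩_{w,∞} − ⟨h, x⟩_{w,∞}` (N2b `pairLayer_X_smul` + `resOfLe ∘ conj = conj ∘ resOfLe`).
[cite: Kato2004Asterisque, §17.13] [cite: NeukirchSchmidtWingberg2008, I §5] -/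
theorem pairInf_X_smul (h : L.H) (x : subgroupH1 κ.kerSubgroup M) :
    L.pairInf M hstabK PG hPred hM ((PowerSeries.X : IwasawaAlgebraO S) • h) x =
      L.pairInf M hstabK PG hPred hM h (conjH1 κ.kerSubgroup M γ⁻¹ x) - L.pairInf M hstabK PG hPred hM h x := by
  obtain ⟨n, c, rfl⟩ := exists_resOfLe_globalLayer_eq (κ := κ) hstabK x
  have hcomm := DFunLike.congr_fun (resOfLe_comp_conjH1_holds (M := M) (κ.kerSubgroup_le_layerSubgroup n) γ⁻¹) c
  simp only [AddMonoidHom.comp_apply] at hcomm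
  rw [pairInf_apply_resOfLe, L.pairLayer_X_smul M hstabK PG hPred hM, ← hcomm, pairInf_apply_resOfLe, pairInf_apply_resOfLe]

/-- ★ **The `𝒪`-balance on the top**: `⟨C a·h, x⟩_{w,∞} = ⟨h, a·x⟩_{w,∞}` (N2b `pairLayer_C_smul` + `resOfLe ∘ scalarH1 = scalarH1 ∘ resOfLe`), given the balance `hPsc` of honda's level pairings.
[cite: Kato2004Asterisque, §17.13] [cite: Rubin2000, §4.2] -/
theorem pairInf_C_smul [Module (padicCoeffIntegers S) M] [SMulCommClass (absoluteGaloisGroup K) (padicCoeffIntegers S) M]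
    (hPsc : ∀ (k : ℕ) (a : padicCoeffIntegers S) (x : ↥(Representation.invariants ((muTwistO S θ' k).toRepresentation.comp (ramificationSubgroup K P).subtype)))
      (m : ↥(torsionPow M p k)), (PG k).toLin (coeffMapO S P θ' (oMuScalar S (p ^ k) a) (oMuScalar_muTwistO S θ' k a) x) m = (PG k).toLin x (a • m))
    (a : padicCoeffIntegers S) (h : L.H) (x : subgroupH1 κ.kerSubgroup M) :
    L.pairInf M hstabK PG hPred hM ((PowerSeries.C a : IwasawaAlgebraO S) • h) x =
      L.pairInf M hstabK PG hPred hM h (GreenbergSelmer.scalarH1 κ.kerSubgroup M a x) := by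
  obtain ⟨n, c, rfl⟩ := exists_resOfLe_globalLayer_eq (κ := κ) hstabK x
  have hcomm := DFunLike.congr_fun (GreenbergSelmer.resOfLe_comp_scalarH1 (M := M) (κ.kerSubgroup_le_layerSubgroup n) a) c
  simp only [AddMonoidHom.comp_apply] at hcomm
  rw [pairInf_apply_resOfLe, L.pairLayer_C_smul M hstabK PG hPred hM hPsc, ← hcomm, pairInf_apply_resOfLe]

end Tower

end SemilocIwasawaCohomologyDataO

end Summit.BirchSwinnertonDyer.BirchSwinnertonDyer.Theorems.SmallImageRttD2Seq

end
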